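import Mathlib
import Summits.NavierStokesRegularity.NavierStokesRegularity.Theses.AmplitudeIndex
import HarnessLib

/-!
# Route AmplitudeIndex — `Assembly` PROVED (stmt-NavierStokesRegularity-10566; pure logic)

`ThresholdEnstrophyStable → StableTangentFlowLiouville → MarginalBlowupTypeI → GIPL3Stability →
CriticalViscosityOfGIP → KatoToClay → NavierStokesRegularity`: exactly the route's deciding theorem
`closes`, curried (no global Kato solution ⇒ a critical viscosity with a marginal Type-I blow-up ⇒ a
stable tangent flow with a non-vanishing point, excluded by the stable Liouville theorem).

HONEST FRAMING: pure logic; the route's cruxes remain OPEN hypotheses; nothing here bears on the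
regularity question. Lands `--workitem stmt-NavierStokesRegularity-10566` (typer seat g19 of cell
pub-ns-dss, idle-row item).
-/

namespace Summit.NavierStokesRegularity.NavierStokesRegularity.Theorems

set_option linter.dupNamespace false

/-- **`Assembly` of route AmplitudeIndex (stmt-NavierStokesRegularity-10566)**, the curried deciding
theorem (pure logic). [this file] -/
theorem amplitudeIndex_assembly_proof : Theses.AmplitudeIndex.Assembly := by
  intro hT hS hM hGIP hCV hKC ν hν u₀ hsm hdiv hdec
  refine hKC ν hν u₀ hsm hdiv hdec ?_
  by_contra hnot
  obtain ⟨νc, hle, hnc, hglob⟩ := hCV hGIP ν hν u₀ hsm hdiv hdec hnot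
  have hνc : 0 < νc := lt_of_lt_of_le hν hle
  obtain ⟨v, hmild, hsmooth, hdecay, hstable, t, ht, x, hx⟩ :=
    hT νc hνc u₀ hsm hdiv hdec hglob hnc (hM νc hνc u₀ hsm hdiv hdec hglob hnc)
  exact hx (hS v hmild hsmooth hdecay hstable t ht x)

end Summit.NavierStokesRegularity.NavierStokesRegularity.Theorems
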